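import Summits.Ventures.QEC.Census.RefinedGridTransform
import Summits.Ventures.QEC.Census.RefinedPairCertificateSound
import HarnessLib

/-!
# Certificates for CRSS's refined LP of the pair `(C, C′)`: the leaf check with TRANSFORMED tables and its soundness

Venture QEC (cell `qec`, LADDER-QEC rung X1; row 06). `RefinedPairCertificate(Sound).lean` check pair certificates
(`RLeafP` / `RTreeP`) for CRSS's refined linear program of the pair `(C, C′)` [CalderbankEtAl1998, §7 Thm. 21 and (ii)]
with the grid tables `gridTabF`; at `(n, w₀) = (27, 24)` — the cell `(27,15)` closed in print by [LaiAshikhmin2018,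
§5.2] — the kernel cannot evaluate them (memory). `rleafOKQ` below is LITERALLY `rleafOKP` with the tables replaced by
`ptab` (moments, `RefinedGridMoments.lean`) and `ttab` (nested Krawtchouk transforms, `RefinedGridTransform.lean`);
because those agree with the grid tables at every entry the check reads (valid classes: `c` even, `b + c ≤ w₀`), a
leaf / tree that passes the new check passes the old one (`rleafOKP_of_rleafOKQ`, `checkPathP_of_checkPathQ` — logical
implications; `rleafOKP` is never evaluated), and soundness is `not_crssRefinedPairFeasible_of_checkP` verbatim:
`not_crssRefinedPairFeasible_of_checkQ`. The SAME certificate data (`RLeafP`) is used. HONEST FRAMING: nonexistence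
only; nothing here certifies a distance; per-cell certificates are DATA files `Census/IPBounds/…`.
[cite: CalderbankEtAl1998, §7 (ii)–(iii) (printed p. 28)]; [cite: MacWilliamsSloane1977, Ch. 17 §4 Thm. 20].
-/

namespace Summit.Ventures.QEC.Census

open Finset Literature.InformationTheory.QuantumCodes

/-! ### 1. The check -/

section Check

variable (n k d e w₀ : ℕ)

/-- **The pair leaf check with tables by moments and Krawtchouk transforms**: literally `rleafOKP` with
`TP := ptab`, `TT := ttab TP` (both blocks); since the tables agree with the grid tables wherever the check reads them,
`rleafOKQ = true → rleafOKP = true` (`rleafOKP_of_rleafOKQ`). Cost at `(n, w₀) = (27, 24)`: ≈ `2·10⁵` streamed products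
against ≈ `3·10⁶` table products of `rleafOKP` (kernel memory wall, measured). Column: definition (ours).
[cite: MacWilliamsSloane1977, Ch. 17 §4 Thm. 20] -/
def rleafOKQ (path : List RSplit) (L : RLeafP) : Bool :=
  let TP := ptab (n - w₀) w₀ L.G.mus
  let TT := ttab (n - w₀) w₀ TP
  let TP2 := ptab (n - w₀) w₀ L.mus2
  let TT2 := ttab (n - w₀) w₀ TP2
  decide (w₀ ≤ n) && signsOK (baseRows n k d e) L.G.base && splitSignsOK path L.G.smult &&
  ((List.range (n + 1)).all fun j =>
    decide (coefAG n k d e path L.G j ≤ 0) && decide (coefBG n k d e path L.G j ≤ 0) &&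
      decide (coefWP n k d e path L j ≤ 0)) &&
  ((List.range (n - w₀ + 1)).all fun a => (List.range (w₀ + 1)).all fun b => (List.range (w₀ + 1)).all fun c =>
    (decide (Odd c) || decide (w₀ < b + c)) ||
    ((!(decide (d ≤ a + b + c)) || decide (0 ≤ get3 L.G.kap a b c)) && decide (0 ≤ get3 L.kap2 a b c) &&
      decide (coefRP w₀ TT TT2 path L a b c ≤ 0) && decide (coefRpP n k w₀ TP path L a b c ≤ 0) &&
      decide (coefRppP n k e w₀ TP2 L a b c ≤ 0))) &&
  decide (0 < leafRhsG n k d e path L.G)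

/-- The pair tree check with `rleafOKQ` leaves. Column: definition (ours). [cite: MacWilliamsSloane1977, Ch. 17 §4 Thm. 20] -/
def RTreeP.checkPathQ : RTreeP → List RSplit → Bool
  | .leaf L, path => rleafOKQ n k d e w₀ path L
  | .split ca cb cw cr crp v le ge, path =>
    le.checkPathQ (path ++ [⟨ca, cb, cw, cr, crp, v, false⟩]) && ge.checkPathQ (path ++ [⟨ca, cb, cw, cr, crp, v, true⟩])

/-- The pair checker (transformed tables) for `CRSSRefinedPairFeasible n k d w₀` in parity branch `e`.
Column: definition (ours). [cite: CalderbankEtAl1998, §7 (ii)] -/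
def RTreeP.checkQ (t : RTreeP) : Bool := t.checkPathQ n k d e w₀ []

end Check

/-! ### 2. Implication to the grid check, soundness -/

/-- `coefRP` only reads the entry `(a, b, c)` of its tables. [folklore] -/
theorem coefRP_congr {w₀ : ℕ} {TT TT' TT2 TT2' : List (List (List ℤ))} {path : List RSplit} {L : RLeafP} {a b c : ℕ}
    (h1 : get3 TT a b c = get3 TT' a b c) (h2 : get3 TT2 a b c = get3 TT2' a b c) :
    coefRP w₀ TT TT2 path L a b c = coefRP w₀ TT' TT2' path L a b c := by
  simp only [coefRP, coefRG, h1, h2]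

/-- `coefRpP` only reads the entry `(a, b, c)` of its table. [folklore] -/
theorem coefRpP_congr {n k w₀ : ℕ} {TP TP' : List (List (List ℤ))} {path : List RSplit} {L : RLeafP} {a b c : ℕ}
    (h : get3 TP a b c = get3 TP' a b c) : coefRpP n k w₀ TP path L a b c = coefRpP n k w₀ TP' path L a b c := by
  simp only [coefRpP, coefRpG, h]

/-- `coefRppP` only reads the entry `(a, b, c)` of its table. [folklore] -/
theorem coefRppP_congr {n k e w₀ : ℕ} {TP TP' : List (List (List ℤ))} {L : RLeafP} {a b c : ℕ}
    (h : get3 TP a b c = get3 TP' a b c) : coefRppP n k e w₀ TP L a b c = coefRppP n k e w₀ TP' L a b c := by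
  simp only [coefRppP, h]

/-- **A leaf that passes the transformed check passes the grid check** (the two checks read equal table entries on the
valid classes; a logical implication — `rleafOKP` is never evaluated). Column: proved (ours). [cite: MacWilliamsSloane1977, Ch. 17 §4 Thm. 20] -/
theorem rleafOKP_of_rleafOKQ {n k d e w₀ : ℕ} {path : List RSplit} {L : RLeafP}
    (h : rleafOKQ n k d e w₀ path L = true) : rleafOKP n k d e w₀ path L = true := by
  simp only [rleafOKQ, Bool.and_eq_true, List.all_eq_true, List.mem_range, decide_eq_true_eq,
    Bool.or_eq_true, Bool.not_eq_true', decide_eq_false_iff_not] at h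
  simp only [rleafOKP, Bool.and_eq_true, List.all_eq_true, List.mem_range, decide_eq_true_eq,
    Bool.or_eq_true, Bool.not_eq_true', decide_eq_false_iff_not]
  obtain ⟨⟨⟨⟨⟨hwn, hsig⟩, hssig⟩, hABW⟩, hRRp⟩, hrhs⟩ := h
  refine ⟨⟨⟨⟨⟨hwn, hsig⟩, hssig⟩, hABW⟩, fun a ha b hb c hc => ?_⟩, hrhs⟩
  rcases hRRp a ha b hb c hc with hskip | ⟨⟨⟨hk, hR⟩, hRp⟩, hRpp⟩
  · exact Or.inl hskip
  · by_cases hv : Odd c ∨ w₀ < b + c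
    · exact Or.inl hv
    · have ha' : a ≤ n - w₀ := by omega
      have hb' : b ≤ w₀ := by omega
      have hc' : c ≤ w₀ := by omega
      refine Or.inr ⟨⟨⟨hk, ?_⟩, ?_⟩, ?_⟩
      · rw [coefRP_congr (ttab_eq_gridTabF (n - w₀) w₀ L.G.mus ha' hb' hc' hv).symm
          (ttab_eq_gridTabF (n - w₀) w₀ L.mus2 ha' hb' hc' hv).symm]
        exact hR
      · rw [coefRpP_congr (ptab_eq_gridTabF (n - w₀) w₀ L.G.mus ha' hb' hc').symm]
        exact hRp
      · rw [coefRppP_congr (ptab_eq_gridTabF (n - w₀) w₀ L.mus2 ha' hb' hc').symm]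
        exact hRpp

/-- Tree version of `rleafOKP_of_rleafOKQ`. Column: proved (ours). [cite: MacWilliamsSloane1977, Ch. 17 §4 Thm. 20] -/
theorem checkPathP_of_checkPathQ {n k d e w₀ : ℕ} (t : RTreeP) :
    ∀ path : List RSplit, t.checkPathQ n k d e w₀ path = true → t.checkPathP n k d e w₀ path = true := by
  induction t with
  | leaf L => intro path h; exact rleafOKP_of_rleafOKQ h
  | split ca cb cw cr crp v le ge ihl ihg =>
    intro path h
    simp only [RTreeP.checkPathQ, RTreeP.checkPathP, Bool.and_eq_true] at h ⊢
    exact ⟨ihl _ h.1, ihg _ h.2⟩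

/-- **Two pair certificates checked with transformed tables (one per parity branch) refute the refined system of the
pair `(C, C′)`** — UNCONDITIONAL, soundness transferred from `not_crssRefinedPairFeasible_of_checkP`. Column: proved (ours).
[cite: CalderbankEtAl1998, §7 (ii) (printed p. 28)] -/
theorem not_crssRefinedPairFeasible_of_checkQ {n k d w₀ : ℕ} (t₀ t₁ : RTreeP) (h₀ : t₀.checkQ n k d 0 w₀ = true)
    (h₁ : t₁.checkQ n k d 1 w₀ = true) : ¬ CRSSRefinedPairFeasible n k d w₀ :=
  not_crssRefinedPairFeasible_of_checkP t₀ t₁ (checkPathP_of_checkPathQ t₀ [] h₀) (checkPathP_of_checkPathQ t₁ [] h₁)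

end Summit.Ventures.QEC.Census
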